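import Mathlib
import Summits.ResolutionOfSingularities.ResolutionOfSingularities.Theorems.WildQuotientsWildQuotientResolutionJordanFourI6Abstract
import Summits.ResolutionOfSingularities.ResolutionOfSingularities.Theorems.WildQuotientsWildQuotientResolutionReesChartTheta
import HarnessLib

/-!
# Programme V4U, package T2 (d): the piece `W_T = D₊(T't) ∩ D₊(H'³t²)` of `Bl_{I₆} 𝔸ⁿ` and the three-piece cover

(crux stmt-ResolutionOfSingularities-15640 `WildQuotients.WildQuotientResolution`, line `Sketch`,
sector `|G| = p`; programme V4U of `L/w45c/CHAIN.md` v6 §4 row stub-2, design of record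
`L/w45c/V4U-DESIGN.md` §3/§5 («COVER»); [OURS · L1 W4.5c] — NOT a statement of any manuscript;
replaces the role of no printed item.)

`V = Bl_{I₆} 𝔸ⁿ = Proj k[x][I₆t]`, `I₆ = (g)` for an ABSTRACT `g : Fin 8 → k[x]` with `g j =` the monomials of
record `x_a², x_ax_b², x_ax_bx_c, x_ax_c³, x_b³, x_b²x_c², x_bx_c⁴, x_c⁶` (instantiate with the vector of
record and `rfl`, see `…JordanFourI6Abstract`), `T' = x_b³ − 3x_ax_bx_c + 3x_a²x_d − x_a²x_b`
(`∈ I₆`, `…JordanFourChartTMembers`), `H' = x_b² − x_ax_b − 2x_ax_c` (`H'³ ∈ I₆²`). The `σ`-stable affine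
piece at the `μ₂`-vertex is, BY DEFINITION OF RECORD (stub-2 owns `W_T`),
**`W_T := D₊(T't · H'³t²) = D₊(T't) ⊓ D₊(H'³t²)`** (`Proj.basicOpen` of the degree-`3` element
`reesT T' · ⟨H'³t²⟩`; on `D₊(T't)` it is the non-vanishing locus of `θ = (H'³t²)/(T't)²`). This file:
`W_T` is an affine open (`isAffineOpen_chartT`), and **the three-piece cover
`D₊(x_a²t) ∪ W_T ∪ D₊(x_c⁶t) = V`** (`vertexChartA_sup_chartT_sup_vertexChartC_eq_top`): a point of the
`μ₂`-vertex chart `D₊(x_b³t)` outside the other two vertex charts has `x_a²t, x_c⁶t` in its homogeneous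
prime, hence `x_ax_bx_ct` and `x_ax_b²t` too (Rees identities `(x_ax_bx_ct)⁶ = (x_a²t)³(x_b³t)²(x_c⁶t)`,
`(x_ax_b²t)³ = x_a(x_a²t)(x_b³t)²`, p489593), so that `T't ≡ x_b³t` and `H'³t² ≡ (x_b³t)²` modulo the
prime — both outside it. Stability of `W_T` under the lifted `J₄`-action and `Γ(V, W_T) ≅ E_Q`:
`…JordanFourChartTStable`.
-/

-- single-problem summit: the doubled namespace component `ResolutionOfSingularities` is forced
set_option linter.dupNamespace false

noncomputable section

open MvPolynomial Polynomial AlgebraicGeometry TopologicalSpace HomogeneousLocalization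
open Literature.AlgebraicGeometry.Resolution

namespace Summit.ResolutionOfSingularities.ResolutionOfSingularities.Theorems.WildQuotientResolution.JordanFour

variable (k : Type) [Field k] (n : ℕ) (a b c d : Fin n) (g : Fin 8 → MvPolynomial (Fin n) k)
  (hg0 : g 0 = X a ^ 2) (hg1 : g 1 = X a * X b ^ 2) (hg2 : g 2 = X a * X b * X c) (hg3 : g 3 = X a * X c ^ 3)
  (hg4 : g 4 = X b ^ 3) (hg5 : g 5 = X b ^ 2 * X c ^ 2) (hg6 : g 6 = X b * X c ^ 4) (hg7 : g 7 = X c ^ 6)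

local notation3 "I6" => Ideal.span (Set.range g)
local notation3 "Tp" => (X b ^ 3 - 3 * X a * X b * X c + 3 * X a ^ 2 * X d - X a ^ 2 * X b :
  MvPolynomial (Fin n) k)
local notation3 "Hp" => (X b ^ 2 - X a * X b - 2 * X a * X c : MvPolynomial (Fin n) k)
local notation3 "hT" => Tprime_mem_span k n a b c d g hg0 hg1 hg2 hg3 hg4 hg5 hg6 hg7
local notation3 "hH3" => Hcube_mem_span_sq k n a b c g hg0 hg1 hg2 hg3 hg4 hg5 hg6
/-- the degree-two numerator `H'³ t²` -/
local notation3 (prettyPrint := false) "H3num" => (⟨monomial 2 (Hp ^ 3), reesAlgebra.monomial_mem.mpr hH3⟩ : reesAlgebra I6)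
/-- the Rees generator `g_j t` -/
local notation3 (prettyPrint := false) "gT" j => reesT (I := I6) (g j) (Ideal.mem_span_range_self (f := g) (x := j))
/-- `W_T = D₊(T't · H'³t²)` -/
local notation3 (prettyPrint := false) "WT" => Proj.basicOpen (reesGrading I6) (reesT Tp hT * H3num)

/-! ### The element `T't · H'³t²` and the open `W_T` -/

include hg0 hg1 hg2 hg3 hg4 hg5 hg6 hg7 in
/-- `T't · H'³t²` has degree `3 = 1 + 2`. [folklore] -/
theorem reesT_Tprime_mul_H3num_mem : reesT Tp hT * H3num ∈ reesGrading I6 (1 + 2 • 1) :=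
  SetLike.mul_mem_graded (reesT_mem Tp hT) (monomial_two_mem_reesGrading k n g (Hp ^ 3) hH3)

include hg0 hg1 hg2 hg3 hg4 hg5 hg6 hg7 in
/-- `W_T = D₊(T't) ⊓ D₊(H'³t²)`. [folklore] -/
theorem chartT_eq_inf : WT = Proj.basicOpen (reesGrading I6) (reesT Tp hT) ⊓ Proj.basicOpen (reesGrading I6) H3num :=
  Proj.basicOpen_mul _ _ _

include hg0 hg1 hg2 hg3 hg4 hg5 hg6 hg7 in
/-- **`W_T` is an affine open of `Bl_{I₆} 𝔸ⁿ`** (the basic open of a homogeneous element of positive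
degree). [folklore] -/
theorem isAffineOpen_chartT : IsAffineOpen WT :=
  Proj.isAffineOpen_basicOpen _ _ (reesT_Tprime_mul_H3num_mem k n a b c d g hg0 hg1 hg2 hg3 hg4 hg5 hg6 hg7)
    (by norm_num)

/-! ### Rees-algebra identities: `T't` and `H'³t²` on the generators -/

include hg0 hg1 hg2 hg3 hg4 hg5 hg6 hg7 in
/-- `T't = x_b³t − 3·x_ax_bx_ct + (3x_d − x_b)·x_a²t` in the Rees algebra. [folklore] -/
theorem reesT_Tprime_eq :
    reesT Tp hT = (gT 4) + algebraMap (MvPolynomial (Fin n) k) (reesAlgebra I6) (-3) * (gT 2) +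
      algebraMap (MvPolynomial (Fin n) k) (reesAlgebra I6) (3 * X d - X b) * (gT 0) := by
  apply Subtype.ext
  have hm : ∀ u v : MvPolynomial (Fin n) k, monomial 1 u + monomial 1 v = monomial 1 (u + v) :=
    fun u v => (map_add _ u v).symm
  simp only [Subalgebra.coe_add, Subalgebra.coe_mul, Subalgebra.coe_algebraMap, coe_reesT, hg0, hg2, hg4,
    Polynomial.algebraMap_eq, Polynomial.C_mul_monomial, hm]
  exact congrArg _ (by ring)

include hg0 hg1 hg2 hg3 hg4 hg5 hg6 in
/-- `H'³t² = Σ c_{jk} (g_jt)(g_kt)` in the Rees algebra (cofactor table `hcube_eq_cofactors`; only the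
eight non-zero products). [folklore] -/
theorem H3num_eq :
    H3num = algebraMap (MvPolynomial (Fin n) k) (reesAlgebra I6) (-(X b) - 6 * X c) * ((gT 0) * (gT 1)) +
      algebraMap (MvPolynomial (Fin n) k) (reesAlgebra I6) (-12 * X c) * ((gT 0) * (gT 2)) +
      algebraMap (MvPolynomial (Fin n) k) (reesAlgebra I6) (-8) * ((gT 0) * (gT 3)) +
      algebraMap (MvPolynomial (Fin n) k) (reesAlgebra I6) (3 * X b + 12 * X c) * ((gT 0) * (gT 4)) +
      algebraMap (MvPolynomial (Fin n) k) (reesAlgebra I6) 12 * ((gT 0) * (gT 5)) +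
      algebraMap (MvPolynomial (Fin n) k) (reesAlgebra I6) (-3) * ((gT 1) * (gT 4)) +
      algebraMap (MvPolynomial (Fin n) k) (reesAlgebra I6) (-6) * ((gT 2) * (gT 4)) +
      (gT 4) * (gT 4) := by
  apply Subtype.ext
  have hm : ∀ u v : MvPolynomial (Fin n) k, monomial 2 u + monomial 2 v = monomial 2 (u + v) :=
    fun u v => (map_add _ u v).symm
  simp only [Subalgebra.coe_add, Subalgebra.coe_mul, Subalgebra.coe_algebraMap, coe_reesT, hg0, hg1, hg2, hg3,
    hg4, hg5, Polynomial.algebraMap_eq, Polynomial.monomial_mul_monomial, Nat.reduceAdd,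
    Polynomial.C_mul_monomial, hm]
  change monomial 2 (Hp ^ 3) = _
  rw [hcube_eq_cofactors]
  exact congrArg _ (by ring)

/-! ### The three-piece cover -/

include hg0 hg1 hg2 hg3 hg4 hg5 hg6 hg7 in
/-- **`D₊(x_a²t) ∪ W_T ∪ D₊(x_c⁶t) = Bl_{I₆} 𝔸ⁿ`** (V4U-DESIGN §5 COVER): the `μ₃`-vertex chart, the
twisted-root-chart piece `W_T = D₊(T't) ∩ D₊(H'³t²)` and the smooth vertex chart cover the blowing
up. Given the vertex-chart cover (`vertexCharts_eq_top`), a point of `D₊(x_b³t)` outside `D₊(x_a²t) ∪ D₊(x_c⁶t)` has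
`x_a²t, x_c⁶t` — hence `x_ax_bx_ct`, `x_ax_b²t` — in its homogeneous prime `𝔭 ∌ x_b³t`, and
`T't ≡ x_b³t`, `H'³t² ≡ (x_b³t)² (mod 𝔭)`. [OURS · L1 W4.5c] [folklore] -/
theorem vertexChartA_sup_chartT_sup_vertexChartC_eq_top :
    Proj.basicOpen (reesGrading I6) (gT 0) ⊔ WT ⊔ Proj.basicOpen (reesGrading I6) (gT 7) = ⊤ := by
  refine top_le_iff.mp fun x _ => ?_
  have hx : x ∈ Proj.basicOpen (reesGrading I6) (gT 0) ⊔ Proj.basicOpen (reesGrading I6) (gT 4) ⊔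
      Proj.basicOpen (reesGrading I6) (gT 7) := by
    rw [vertexCharts_eq_top k n a b c g hg0 hg1 hg2 hg3 hg4 hg5 hg6 hg7]; trivial
  by_cases h0 : x ∈ Proj.basicOpen (reesGrading I6) (gT 0)
  · exact Opens.mem_sup.mpr (Or.inl (Opens.mem_sup.mpr (Or.inl h0)))
  by_cases h7 : x ∈ Proj.basicOpen (reesGrading I6) (gT 7)
  · exact Opens.mem_sup.mpr (Or.inr h7)
  have h4 : x ∈ Proj.basicOpen (reesGrading I6) (gT 4) := by
    rcases Opens.mem_sup.mp hx with h | h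
    · rcases Opens.mem_sup.mp h with h | h
      · exact absurd h h0
      · exact h
    · exact absurd h h7
  refine Opens.mem_sup.mpr (Or.inl (Opens.mem_sup.mpr (Or.inr ?_)))
  -- translate into the homogeneous prime `𝔭` of `x`
  have hprime : x.asHomogeneousIdeal.toIdeal.IsPrime := x.isPrime
  rw [Proj.mem_basicOpen] at h0 h4 h7 ⊢
  rw [not_not] at h0 h7
  change (gT 0) ∈ x.asHomogeneousIdeal.toIdeal at h0
  change (gT 7) ∈ x.asHomogeneousIdeal.toIdeal at h7
  change (gT 4) ∉ x.asHomogeneousIdeal.toIdeal at h4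
  change reesT Tp hT * H3num ∉ x.asHomogeneousIdeal.toIdeal
  generalize x.asHomogeneousIdeal.toIdeal = P at hprime h0 h4 h7 ⊢
  -- `x_ax_bx_c t ∈ 𝔭` and `x_ax_b² t ∈ 𝔭`
  have h2 : (gT 2) ∈ P := by
    refine hprime.mem_of_pow_mem 6 ?_
    rw [reesT_two_pow k n a b c g hg0 hg2 hg4 hg7]
    exact P.mul_mem_right _ (P.mul_mem_right _ (P.pow_mem_of_mem h0 3 (by norm_num)))
  have h1 : (gT 1) ∈ P := by
    refine hprime.mem_of_pow_mem 3 ?_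
    rw [reesT_one_pow k n a b g hg0 hg1 hg4]
    exact P.mul_mem_left _ (P.mul_mem_right _ h0)
  -- `T't ∉ 𝔭`
  have hTp : reesT Tp hT ∉ P := by
    intro h
    apply h4
    have h' : reesT Tp hT - (algebraMap (MvPolynomial (Fin n) k) (reesAlgebra I6) (-3) * (gT 2) +
        algebraMap (MvPolynomial (Fin n) k) (reesAlgebra I6) (3 * X d - X b) * (gT 0)) ∈ P :=
      P.sub_mem h (P.add_mem (P.mul_mem_left _ h2) (P.mul_mem_left _ h0))
    rw [reesT_Tprime_eq k n a b c d g hg0 hg1 hg2 hg3 hg4 hg5 hg6 hg7] at h'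
    convert h' using 1
    ring
  -- `H'³t² ∉ 𝔭`
  have hH : H3num ∉ P := by
    intro h
    apply h4
    refine hprime.mem_of_pow_mem 2 ?_
    have h' : H3num - (algebraMap (MvPolynomial (Fin n) k) (reesAlgebra I6) (-(X b) - 6 * X c) *
        ((gT 0) * (gT 1)) +
      algebraMap (MvPolynomial (Fin n) k) (reesAlgebra I6) (-12 * X c) * ((gT 0) * (gT 2)) +
      algebraMap (MvPolynomial (Fin n) k) (reesAlgebra I6) (-8) * ((gT 0) * (gT 3)) +
      algebraMap (MvPolynomial (Fin n) k) (reesAlgebra I6) (3 * X b + 12 * X c) * ((gT 0) * (gT 4)) +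
      algebraMap (MvPolynomial (Fin n) k) (reesAlgebra I6) 12 * ((gT 0) * (gT 5)) +
      algebraMap (MvPolynomial (Fin n) k) (reesAlgebra I6) (-3) * ((gT 1) * (gT 4)) +
      algebraMap (MvPolynomial (Fin n) k) (reesAlgebra I6) (-6) * ((gT 2) * (gT 4))) ∈ P := by
      refine P.sub_mem h ?_
      refine P.add_mem (P.add_mem (P.add_mem (P.add_mem (P.add_mem (P.add_mem ?_ ?_) ?_) ?_) ?_) ?_) ?_
      · exact P.mul_mem_left _ (P.mul_mem_right _ h0)
      · exact P.mul_mem_left _ (P.mul_mem_right _ h0)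
      · exact P.mul_mem_left _ (P.mul_mem_right _ h0)
      · exact P.mul_mem_left _ (P.mul_mem_right _ h0)
      · exact P.mul_mem_left _ (P.mul_mem_right _ h0)
      · exact P.mul_mem_left _ (P.mul_mem_right _ h1)
      · exact P.mul_mem_left _ (P.mul_mem_right _ h2)
    rw [H3num_eq k n a b c g hg0 hg1 hg2 hg3 hg4 hg5 hg6] at h'
    convert h' using 1
    ring
  exact fun h => (hprime.mem_or_mem h).elim hTp hH

end Summit.ResolutionOfSingularities.ResolutionOfSingularities.Theorems.WildQuotientResolution.JordanFour

end
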